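import Literature.MathematicalPhysics.QuantumFieldTheory.TorusChartSpinWaveGauge
import Literature.MathematicalPhysics.QuantumFieldTheory.TorusChartPinnedUnfolding
import Literature.MathematicalPhysics.QuantumFieldTheory.TorusChartFlatCochains
import Literature.Probability.LatticeModels.GaussianLinearImage
import HarnessLib

/-!
# The pinned Gaussian: normalisation of a shift-invariant quadratic weight on the pinned real fields

After the Fröhlich–Spencer unfolding of a `U(1)`-invariant lattice model on a finite torus `Λ` and the
Coulomb square completion, each vorticity sector carries the same Gaussian backbone
`e^{-½ ⟨φ, H φ⟩} dφ` on the PINNED real fields `pinnedSet Λ = {φ : φ 0 ∈ [0, 2π)}`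
(`TorusChartPinnedUnfolding`), where `H` is a real symmetric matrix killing the constants (`H 1 = 0`:
the weight only sees gradients).  This file computes its normalisation and gives the positivity
criterion used to make it a genuine (finite, non-degenerate) Gaussian:

* `TorusChart.dotProduct_mulVec_add_const` — shift invariance `⟨φ + a, H(φ + a)⟩ = ⟨φ, Hφ⟩` for symmetric
  `H` with `H 1 = 0`;
* `TorusChart.dotProduct_mulVec_extZero` — on fields vanishing at the origin the form is the form of the
  principal submatrix `H' = H|_{Λ∖0}`: `⟨extZero ψ, H extZero ψ⟩ = ⟨ψ, H' ψ⟩`;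
* **`TorusChart.setIntegral_pinnedSet_exp_neg_quadratic`**:
  `∫_{pinnedSet Λ} e^{-½⟨φ,Hφ⟩} dφ = 2π · Z_{H'}`, `Z_{H'} = gaussZ H' = ∫_{ℝ^{Λ∖0}} e^{-½⟨ψ,H'ψ⟩} dψ`
  (the zero mode contributes the period `2π`, seat of the gauge fixing `setIntegral_inter_eval_zero_mem_eq_smul`);
* `TorusChart.integrableOn_pinnedSet_exp_neg_quadratic` — integrability on the pinned set when `H'` is
  positive definite, and `setIntegral_pinnedSet_exp_neg_quadratic_pos` (the normalisation is `> 0`);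
* **`TorusChart.posDef_submatrix_of_d₀_coercive`** — if `⟨φ, Hφ⟩ ≥ c · Σ_{x,i} (d₀ φ)(x,i)²` with `c > 0`
  for a torus chart `F` on `Λ` (coercivity on gradients, e.g. from the window-wise second-order condition of
  a coercive interaction), then `H'` is positive definite (a gradient-free field pinned at the origin
  vanishes, `d₀_eq_zero_iff`).

Everything is proved; no named fact is introduced.

## References

* J. Fröhlich, T. Spencer, Comm. Math. Phys. 81 (1981) 527–602, §3 (massless Gaussian / spin waves of
  the Villain model). [folklore form]
-/

noncomputable section

namespace Literature.MathematicalPhysics.QuantumFieldTheory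

open scoped BigOperators
open _root_.MeasureTheory Set Real Matrix

namespace TorusChart

/-! ## Algebra of shift-invariant quadratic forms -/

section Algebra

variable {Λ : Type*} [Fintype Λ]

/-- For a symmetric matrix killing the constants, the row sums vanish too: `1 ᵥ* H = 0`. [folklore] -/
theorem const_vecMul_eq_zero {H : Matrix Λ Λ ℝ} (hH : H.IsSymm) (h1 : H *ᵥ (fun _ => (1 : ℝ)) = 0) :
    (fun _ => (1 : ℝ)) ᵥ* H = 0 := by
  rw [← Matrix.mulVec_transpose, hH.eq, h1]

/-- **Shift invariance**: for symmetric `H` with `H 1 = 0`, `⟨φ + a, H (φ + a)⟩ = ⟨φ, H φ⟩`. [folklore] -/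
theorem dotProduct_mulVec_add_const {H : Matrix Λ Λ ℝ} (hH : H.IsSymm) (h1 : H *ᵥ (fun _ => (1 : ℝ)) = 0)
    (φ : Λ → ℝ) (a : ℝ) :
    (fun x => φ x + a) ⬝ᵥ H *ᵥ (fun x => φ x + a) = φ ⬝ᵥ H *ᵥ φ := by
  have hφa : (fun x => φ x + a) = φ + a • (fun _ => (1 : ℝ)) := by
    funext x; simp
  have hr : H *ᵥ (a • fun _ => (1 : ℝ)) = 0 := by rw [Matrix.mulVec_smul, h1, smul_zero]
  have hl : (a • fun _ => (1 : ℝ)) ⬝ᵥ H *ᵥ φ = 0 := by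
    rw [Matrix.dotProduct_mulVec, Matrix.smul_vecMul, const_vecMul_eq_zero hH h1, smul_zero, zero_dotProduct]
  rw [hφa, Matrix.mulVec_add, hr, add_zero, add_dotProduct, hl, add_zero]

variable [DecidableEq Λ] [Zero Λ]

/-- A sum over the torus of a function vanishing at the origin is the sum over the punctured torus.
[folklore] -/
theorem sum_eq_sum_punctured {M : Type*} [AddCommMonoid M] (g : Λ → M) (hg : g 0 = 0) :
    ∑ x, g x = ∑ x : Punctured Λ, g x := by
  rw [Fintype.sum_eq_add_sum_subtype_ne g 0, hg, zero_add]

/-- **The form on fields pinned to `0` at the origin is the form of the principal submatrix**: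
`⟨extZero ψ, H extZero ψ⟩ = ⟨ψ, H|_{Λ∖0} ψ⟩`. [folklore] -/
theorem dotProduct_mulVec_extZero (H : Matrix Λ Λ ℝ) (ψ : Punctured Λ → ℝ) :
    extZero ψ ⬝ᵥ H *ᵥ extZero ψ = ψ ⬝ᵥ (H.submatrix Subtype.val Subtype.val) *ᵥ ψ := by
  have hmul : ∀ x : Λ, (H *ᵥ extZero ψ) x = ∑ y : Punctured Λ, H x y * ψ y := fun x => by
    rw [Matrix.mulVec, dotProduct,
      sum_eq_sum_punctured (fun y => H x y * extZero ψ y) (by rw [extZero_zero, mul_zero])]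
    simp only [extZero_coe]
  rw [dotProduct, sum_eq_sum_punctured (fun x => extZero ψ x * (H *ᵥ extZero ψ) x)
    (by rw [extZero_zero, zero_mul])]
  simp only [extZero_coe, hmul]
  simp only [dotProduct, Matrix.mulVec, Matrix.submatrix_apply]

end Algebra

/-! ## The normalisation of the pinned Gaussian -/

section Integral

variable {Λ : Type*} [Fintype Λ] [DecidableEq Λ] [Zero Λ]

open Literature.Probability.LatticeModels.GaussianCoord
open Literature.MathematicalPhysics.QuantumFieldTheory.GaussianToolkit

/-- **Normalisation of the pinned Gaussian.** For a real symmetric matrix `H` on the finite torus `Λ` with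
`H 1 = 0`, `∫_{φ 0 ∈ [0,2π)} e^{-½⟨φ, Hφ⟩} dφ = 2π · Z_{H'}`, where `H' = H|_{Λ∖0}` and
`Z_{H'} = ∫_{ℝ^{Λ∖0}} e^{-½⟨ψ, H'ψ⟩} dψ` (`gaussZ`). [folklore] -/
theorem setIntegral_pinnedSet_exp_neg_quadratic (H : Matrix Λ Λ ℝ) (hH : H.IsSymm)
    (h1 : H *ᵥ (fun _ => (1 : ℝ)) = 0) :
    ∫ φ in pinnedSet Λ, Real.exp (-(φ ⬝ᵥ H *ᵥ φ) / 2) =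
      2 * π * (gaussZ (H.submatrix Subtype.val Subtype.val :
        Matrix (Punctured Λ) (Punctured Λ) ℝ)).toReal := by
  have hinv : ∀ (φ : Λ → ℝ) (a : ℝ),
      Real.exp (-((fun x => φ x + a) ⬝ᵥ H *ᵥ (fun x => φ x + a)) / 2) = Real.exp (-(φ ⬝ᵥ H *ᵥ φ) / 2) :=
    fun φ a => by rw [dotProduct_mulVec_add_const hH h1]
  have h := setIntegral_inter_eval_zero_mem_eq_smul (Λ := Λ) MeasurableSet.univ (S := Set.univ)
    (fun _ _ => by simp) (fun φ => Real.exp (-(φ ⬝ᵥ H *ᵥ φ) / 2)) hinv (Set.Ico 0 (2 * π))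
  rw [Set.inter_univ] at h
  rw [pinnedSet, h, Real.volume_Ico, ENNReal.toReal_ofReal (by linarith [Real.two_pi_pos]), sub_zero,
    smul_eq_mul]
  congr 1
  have hset : {ψ : Punctured Λ → ℝ | extZero ψ ∈ (Set.univ : Set (Λ → ℝ))} = Set.univ := by
    ext ψ; simp
  rw [hset, Measure.restrict_univ, ← integral_exp_quadratic]
  refine integral_congr_ae (Filter.Eventually.of_forall fun ψ => ?_)
  simp only [dotProduct_mulVec_extZero]

/-- The pinned Gaussian weight is integrable on the pinned set as soon as `H' = H|_{Λ∖0}` is positive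
definite. [folklore] -/
theorem integrableOn_pinnedSet_exp_neg_quadratic (H : Matrix Λ Λ ℝ) (hH : H.IsSymm)
    (h1 : H *ᵥ (fun _ => (1 : ℝ)) = 0)
    (hH' : (H.submatrix Subtype.val Subtype.val : Matrix (Punctured Λ) (Punctured Λ) ℝ).PosDef) :
    IntegrableOn (fun φ : Λ → ℝ => Real.exp (-(φ ⬝ᵥ H *ᵥ φ) / 2)) (pinnedSet Λ) := by
  set f : (Λ → ℝ) → ℝ := fun φ => Real.exp (-(φ ⬝ᵥ H *ᵥ φ) / 2) with hf
  -- pull back along the gauge equivalence `(a, ψ) ↦ extZero ψ + a`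
  have hpre : (gaugeEquiv (Λ := Λ)) ⁻¹' pinnedSet Λ = Set.Ico 0 (2 * π) ×ˢ (Set.univ : Set (Punctured Λ → ℝ)) := by
    ext p
    simp only [Set.mem_preimage, pinnedSet, Set.mem_setOf_eq, gaugeEquiv_apply, gaugeMap_apply_zero, Set.mem_prod,
      Set.mem_univ, and_true]
  have hcomp : (fun p : ℝ × (Punctured Λ → ℝ) => f (gaugeEquiv p)) =
      fun p => Real.exp (-(p.2 ⬝ᵥ (H.submatrix Subtype.val Subtype.val) *ᵥ p.2) / 2) := by
    funext p
    rw [gaugeEquiv_apply, show gaugeMap p = fun x => extZero p.2 x + p.1 from rfl, hf]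
    simp only
    rw [dotProduct_mulVec_add_const hH h1, dotProduct_mulVec_extZero]
  have key : IntegrableOn (fun p : ℝ × (Punctured Λ → ℝ) => f (gaugeEquiv p))
      (Set.Ico 0 (2 * π) ×ˢ (Set.univ : Set (Punctured Λ → ℝ))) (volume.prod volume) := by
    rw [IntegrableOn, ← Measure.prod_restrict, Measure.restrict_univ, hcomp]
    exact (integrable_exp_quadratic _ hH').comp_snd _
  have h := (measurePreserving_gaugeEquiv (Λ := Λ)).integrableOn_comp_preimage
    (gaugeEquiv (Λ := Λ)).measurableEmbedding (f := f) (s := pinnedSet Λ)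
  rw [hpre] at h
  exact h.1 key

/-- The normalisation of a non-degenerate pinned Gaussian is positive. [folklore] -/
theorem setIntegral_pinnedSet_exp_neg_quadratic_pos (H : Matrix Λ Λ ℝ) (hH : H.IsSymm)
    (h1 : H *ᵥ (fun _ => (1 : ℝ)) = 0)
    (hH' : (H.submatrix Subtype.val Subtype.val : Matrix (Punctured Λ) (Punctured Λ) ℝ).PosDef) :
    0 < ∫ φ in pinnedSet Λ, Real.exp (-(φ ⬝ᵥ H *ᵥ φ) / 2) := by
  rw [setIntegral_pinnedSet_exp_neg_quadratic H hH h1]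
  exact mul_pos Real.two_pi_pos (gaussZ_toReal_pos _ hH')

end Integral

/-! ## Non-degeneracy from coercivity on gradients -/

section Coercive

variable {Λ : Type*} [AddCommGroup Λ] [Fintype Λ] [DecidableEq Λ] {d : ℕ} (F : TorusChart Λ d)

/-- **Coercivity on gradients makes the pinned form positive definite.** If a real symmetric `H` satisfies
`c · Σ_{x,i} (d₀ φ)(x,i)² ≤ ⟨φ, Hφ⟩` for all `φ` with `c > 0`, then its principal submatrix on `Λ ∖ 0` is
positive definite: a field with `⟨φ,Hφ⟩ = 0` has vanishing gradient, hence is constant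
(`d₀_eq_zero_iff`), hence vanishes if pinned to `0` at the origin. [folklore] -/
theorem posDef_submatrix_of_d₀_coercive (H : Matrix Λ Λ ℝ) (hH : H.IsSymm) {c : ℝ} (hc : 0 < c)
    (hcoer : ∀ φ : Λ → ℝ, c * ∑ x, ∑ i, (F.d₀ φ x i) ^ 2 ≤ φ ⬝ᵥ H *ᵥ φ) :
    (H.submatrix Subtype.val Subtype.val : Matrix (Punctured Λ) (Punctured Λ) ℝ).PosDef := by
  rw [Matrix.posDef_iff_dotProduct_mulVec]
  refine ⟨?_, fun ψ hψ => ?_⟩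
  · -- symmetric real matrices are Hermitian, and so are their principal submatrices
    have hHh : H.IsHermitian := by
      rw [Matrix.IsHermitian, Matrix.conjTranspose_eq_transpose_of_trivial]; exact hH.eq
    exact hHh.submatrix _
  · rw [star_trivial, ← dotProduct_mulVec_extZero]
    have hsq : 0 ≤ ∑ x, ∑ i, (F.d₀ (extZero ψ) x i) ^ 2 :=
      Finset.sum_nonneg fun _ _ => Finset.sum_nonneg fun _ _ => sq_nonneg _
    rcases hsq.lt_or_eq with hpos | hzero
    · exact lt_of_lt_of_le (mul_pos hc hpos) (hcoer _)
    · -- zero gradient energy: the pinned field is constant, hence zero — contradiction with `ψ ≠ 0`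
      exfalso
      apply hψ
      have hall : ∀ x i, F.d₀ (extZero ψ) x i = 0 := by
        intro x i
        have hx : ∑ i', (F.d₀ (extZero ψ) x i') ^ 2 = 0 := by
          refine le_antisymm ?_ (Finset.sum_nonneg fun _ _ => sq_nonneg _)
          rw [hzero]
          exact Finset.single_le_sum (fun y _ => Finset.sum_nonneg fun _ _ => sq_nonneg _) (Finset.mem_univ x)
        have hxi : (F.d₀ (extZero ψ) x i) ^ 2 = 0 := by
          refine le_antisymm ?_ (sq_nonneg _)
          rw [← hx]
          exact Finset.single_le_sum (fun j _ => sq_nonneg _) (Finset.mem_univ i)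
        exact pow_eq_zero_iff two_ne_zero |>.1 hxi
      have hd : F.d₀ (extZero ψ) = 0 := funext fun x => funext fun i => hall x i
      have hconst := (F.d₀_eq_zero_iff (extZero ψ)).1 hd
      funext x
      have := hconst x
      rw [extZero_zero, extZero_coe] at this
      exact this

end Coercive

end TorusChart

end Literature.MathematicalPhysics.QuantumFieldTheory

end
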